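import Literature.AnabelianGeometry.SemiGraphs.SurfaceTypeEdgeSeparationCore

/-!
# A finite étale covering trivial over one edge and ramified over another ([SemiAnbd] Rmk. 2.10.1)

Mochizuki, *Semi-graphs of anabelioids*, Publ. RIMS **42** (2006), Example 2.10 p. 31, Remark 2.10.1
p. 32: for `𝒢` of surface type `C_{Π_𝒢}(Π_b) = Π_b`, "using exactly the same techniques as those used
in the proofs of Proposition 2.6, Corollary 2.7" [cite: MochizukiSemiAnbd2006, Rem. 2.10.1 p.32].  The
technique (p. 30, proof of Cor. 2.7 (i): a finite étale covering separating `g · ℋ″` from `ℋ″`) needs,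
for two distinct EDGES `e₁ ≠ e₂` of a surface-type `𝒢`, an object of `B(𝒢)` that is TRIVIAL over `e₂`
and NON-TRIVIAL over `e₁`.  This proof-only file (cell abc-iut, layer L3, row F-1477, seat
abc-iut-L3-t12) constructs it (`IsOfSurfaceType.exists_bObj_trivial_nontrivial`) under the one
necessary hypothesis: whenever `e₂` is a loop at a vertex `v` which `e₁` meets, `e₁` is a loop at `v`
too.  (Necessity: if `e₂` is a loop at a genus-`0` vertex `v` with exactly three cusps and `e₁` is the
edge of the third cusp, every covering trivial over `e₂` is trivial over `e₁` —
`PuncturedSurfaceGroup.mem_of_forall_ne_mem`.)  The construction: kill the branch groups of `e₂`;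
at the (at most one) vertex where this is obstructed (`e₂` a loop there, one further cusp), kill
everything and propagate the triviality one step along the third edge — at its other end at most one
branch is killed, which is never obstructed (`…_of_subsingleton`); everywhere else ramify all branch
groups with index `n` (`SurfaceTypeMixedBranchQuotients.lean`), and glue
(`SurfaceTypeEdgeSeparationCore.lean`).  Kernel form at the basepoint through `e₁`'s vertex:
`exists_open_normal_not_le` (an open normal `U ⊴ Π_𝒢` with `Π_{b₁} ⊄ U`, defined by an object trivial
over `e₂`).  No statement here takes a side on any disputed claim; nothing about [IUTchIII] Cor. 3.12.
-/

namespace Literature.AnabelianGeometry.SemiGraphs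

open CategoryTheory CategoryTheory.PreGaloisCategory
open Literature.AnabelianGeometry.Anabelioids
open Topology

universe v₁ u₁ u

namespace SemiGraphOfAnabelioids

variable {𝒢 : SemiGraphOfAnabelioids.{v₁, u₁, u}} {Sigma : Set ℕ}

/-! ### Semi-graph bookkeeping: an edge has exactly two branches -/

/-- Among three branches of one edge, two coincide. [cite: MochizukiSemiAnbd2006, §1 p.11] -/
private theorem branch_eq_or_eq_or_eq {e : 𝒢.graph.Edge} {x y z : 𝒢.graph.Branch}
    (hx : 𝒢.graph.edgeOf x = e) (hy : 𝒢.graph.edgeOf y = e) (hz : 𝒢.graph.edgeOf z = e) :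
    x = y ∨ x = z ∨ y = z := by
  obtain ⟨b₁, b₂, -, -, -, hall⟩ := 𝒢.graph.two_branches e
  rcases hall x hx with rfl | rfl <;> rcases hall y hy with rfl | rfl <;>
    rcases hall z hz with rfl | rfl <;> simp

/-- If two distinct branches of `e` abut to `v`, every branch of `e` abuts to `v`.
[cite: MochizukiSemiAnbd2006, §1 p.11] -/
private theorem abuts_of_two_branches {e : 𝒢.graph.Edge} {v : 𝒢.graph.Vertex}
    {c c' : 𝒢.graph.Branch} (hc : 𝒢.graph.edgeOf c = e) (hc' : 𝒢.graph.edgeOf c' = e) (hne : c ≠ c')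
    (hcv : 𝒢.graph.abuts c = some v) (hc'v : 𝒢.graph.abuts c' = some v)
    (b : 𝒢.graph.Branch) (hb : 𝒢.graph.edgeOf b = e) : 𝒢.graph.abuts b = some v := by
  rcases branch_eq_or_eq_or_eq hb hc hc' with rfl | rfl | h
  · exact hcv
  · exact hc'v
  · exact absurd h hne

/-! ### The separating object -/

/-- **An object of `B(𝒢)` trivial over `e₂` and non-trivial over `e₁`.**  Let `𝒢` be of surface type,
`b₁ ∈ e₁` a branch at `v₁`, `b₂ ∈ e₂` a branch at `v₂`, `e₁ ≠ e₂`, and assume: at every vertex at which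
BOTH branches of `e₂` abut and which `e₁` meets, both branches of `e₁` abut as well.  Then for all
basepoints `F₁` of `𝒢_{e₁}`, `F₂` of `𝒢_{e₂}` there is an `A ∈ B(𝒢)` with `Π_{e₂} = Aut F₂` acting
trivially on `F₂(T_{e₂})` and `Π_{e₁} = Aut F₁` acting non-trivially on `F₁(T_{e₁})`.
[cite: MochizukiSemiAnbd2006, Rem. 2.10.1 p.32] -/
theorem IsOfSurfaceType.exists_bObj_trivial_nontrivial (hS : 𝒢.IsOfSurfaceType Sigma)
    (b₁ : 𝒢.graph.Branch) (v₁ : 𝒢.graph.Vertex) (h₁ : 𝒢.graph.abuts b₁ = some v₁)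
    (b₂ : 𝒢.graph.Branch) (v₂ : 𝒢.graph.Vertex) (h₂ : 𝒢.graph.abuts b₂ = some v₂)
    (hne : 𝒢.graph.edgeOf b₁ ≠ 𝒢.graph.edgeOf b₂)
    (hloop : ∀ v : 𝒢.graph.Vertex,
      (∀ b, 𝒢.graph.edgeOf b = 𝒢.graph.edgeOf b₂ → 𝒢.graph.abuts b = some v) →
      (∃ b, 𝒢.graph.edgeOf b = 𝒢.graph.edgeOf b₁ ∧ 𝒢.graph.abuts b = some v) →
      ∀ b, 𝒢.graph.edgeOf b = 𝒢.graph.edgeOf b₁ → 𝒢.graph.abuts b = some v)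
    (F₁ : 𝒢.E (𝒢.graph.edgeOf b₁) ⥤ FintypeCat.{v₁}) [FiberFunctor F₁]
    (F₂ : 𝒢.E (𝒢.graph.edgeOf b₂) ⥤ FintypeCat.{v₁}) [FiberFunctor F₂] :
    ∃ A : 𝒢.BObj,
      (∀ (σ : Aut F₂) (y : F₂.obj (A.T (𝒢.graph.edgeOf b₂))), σ • y = y) ∧
      ∃ (σ : Aut F₁) (y : F₁.obj (A.T (𝒢.graph.edgeOf b₁))), σ • y ≠ y := by
  classical
  -- a prime `n ∈ Σ`
  obtain ⟨⟨n, hnS⟩, hprimes⟩ := hS.sigma_primes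
  have hnp : n.Prime := hprimes n hnS
  have hn : IsSigmaInteger Sigma n :=
    ⟨hnp.pos, fun p hp hpn => by rwa [(Nat.prime_dvd_prime_iff_eq hp hnp).mp hpn]⟩
  have hn1 : 1 < n := hnp.one_lt
  let Fv : ∀ v : 𝒢.graph.Vertex, 𝒢.V v ⥤ FintypeCat.{v₁} := fun v =>
    GaloisCategory.getFiberFunctor (𝒢.V v)
  -- the construction statement at a vertex, for a set of branches to be killed
  let Good : ∀ v : 𝒢.graph.Vertex, Set (𝒢.graph.Star v) → Prop := fun v Zb =>
    ∃ W : Subgroup (Aut (Fv v)), IsOpen (W : Set (Aut (Fv v))) ∧ W.Normal ∧ W.index ∣ n ^ 3 ∧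
      ∀ (b : 𝒢.graph.Star v) (Fe : 𝒢.E (𝒢.graph.edgeOf b.1) ⥤ FintypeCat.{v₁}) [FiberFunctor Fe],
        ∃ α : (𝒢.pull b.1 v b.2).pullback ⋙ Fe ≅ Fv v,
          (b ∈ Zb → 𝒢.branchSubgroup (Fv v) b.1 b.2 Fe α ≤ W) ∧
          (b ∉ Zb →
            (W : Set (Aut (Fv v))) ∩ (𝒢.branchSubgroup (Fv v) b.1 b.2 Fe α : Set (Aut (Fv v))) =
              closure ((fun x : Aut (Fv v) => x ^ n) ''
                (𝒢.branchSubgroup (Fv v) b.1 b.2 Fe α : Set (Aut (Fv v)))) ∧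
            ¬ 𝒢.branchSubgroup (Fv v) b.1 b.2 Fe α ≤ W)
  -- first attempt: kill the branches of `𝒢.graph.edgeOf b₂`
  let Zb0 : ∀ v : 𝒢.graph.Vertex, Set (𝒢.graph.Star v) := fun v => {b | 𝒢.graph.edgeOf b.1 = 𝒢.graph.edgeOf b₂}
  -- a vertex where this is obstructed carries both branches of `𝒢.graph.edgeOf b₂` …
  have hbad_both : ∀ v, ¬ Good v (Zb0 v) → ∀ b, 𝒢.graph.edgeOf b = 𝒢.graph.edgeOf b₂ → 𝒢.graph.abuts b = some v := by
    intro v hv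
    have hns : ¬ (Zb0 v).Subsingleton := fun hs =>
      hv (hS.exists_open_normal_mixed_of_subsingleton v (Fv v) hn hn1 (Zb0 v) hs)
    obtain ⟨c, hc, c', hc', hcc'⟩ := Set.not_subsingleton_iff.mp hns
    exact abuts_of_two_branches hc hc' (fun h => hcc' (Subtype.ext h)) c.2 c'.2
  -- … hence is unique …
  have hbad_unique : ∀ v v', ¬ Good v (Zb0 v) → ¬ Good v' (Zb0 v') → v = v' := by
    intro v v' hv hv'
    have h1 := hbad_both v hv b₂ rfl
    have h2 := hbad_both v' hv' b₂ rfl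
    rw [h1] at h2
    exact Option.some_injective _ h2
  -- … and has at most one branch outside `𝒢.graph.edgeOf b₂`
  have hbad_one : ∀ v, ¬ Good v (Zb0 v) → ∀ c c' : 𝒢.graph.Star v,
      c ∉ Zb0 v → c' ∉ Zb0 v → c = c' := by
    intro v hv c c' hc hc'
    by_contra hcc'
    exact hv (hS.exists_open_normal_mixed_of_two_branches v (Fv v) hn hn1 (Zb0 v) hc hc' hcc')
  -- … and `𝒢.graph.edgeOf b₁` does not meet it
  have hbad_e₁ : ∀ v, ¬ Good v (Zb0 v) → ∀ b, 𝒢.graph.edgeOf b = 𝒢.graph.edgeOf b₁ → 𝒢.graph.abuts b ≠ some v := by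
    intro v hv b hb hbv
    have hall := hloop v (hbad_both v hv) ⟨b, hb, hbv⟩
    -- both branches of `𝒢.graph.edgeOf b₁` at `v`: two distinct branches outside `Zb0 v`
    obtain ⟨c, c', hcc', hc, hc', -⟩ := 𝒢.graph.two_branches (𝒢.graph.edgeOf b₁)
    have := hbad_one v hv ⟨c, hall c hc⟩ ⟨c', hall c' hc'⟩
      (by simp only [Zb0, Set.mem_setOf_eq, hc]; exact hne)
      (by simp only [Zb0, Set.mem_setOf_eq, hc']; exact hne)
    exact hcc' (congrArg Subtype.val this)
  -- the edges to be killed: `𝒢.graph.edgeOf b₂` and every edge meeting an obstructed vertex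
  let E₁ : Set 𝒢.graph.Edge := {e | e = 𝒢.graph.edgeOf b₂ ∨ ∃ v, ¬ Good v (Zb0 v) ∧
    ∃ b, 𝒢.graph.edgeOf b = e ∧ 𝒢.graph.abuts b = some v}
  let Zb : ∀ v : 𝒢.graph.Vertex, Set (𝒢.graph.Star v) := fun v => {b | 𝒢.graph.edgeOf b.1 ∈ E₁}
  have hZb0_le : ∀ v, Zb0 v ⊆ Zb v := fun v b hb => Or.inl hb
  have hgood : ∀ v, Good v (Zb v) := by
    intro v
    by_cases hv : Good v (Zb0 v)
    · by_cases heq : Zb v ⊆ Zb0 v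
      · -- `Zb v = Zb0 v`
        have : Zb v = Zb0 v := Set.Subset.antisymm heq (hZb0_le v)
        rw [this]; exact hv
      · -- `Zb v` contains a cascade branch: then it has at most one element
        refine hS.exists_open_normal_mixed_of_subsingleton v (Fv v) hn hn1 (Zb v) ?_
        obtain ⟨x, hxZ, hx0⟩ := Set.not_subset.mp heq
        -- the obstructed vertex `v'` behind `x`
        have hx' : ∃ v', ¬ Good v' (Zb0 v') ∧ ∃ b, 𝒢.graph.edgeOf b = 𝒢.graph.edgeOf x.1 ∧
            𝒢.graph.abuts b = some v' := by
          rcases hxZ with h | h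
          · exact absurd h hx0
          · exact h
        obtain ⟨v', hv', bx, hbx, hbxv'⟩ := hx'
        have hvv' : v ≠ v' := by rintro rfl; exact hv' hv
        -- no branch of `𝒢.graph.edgeOf b₂` at `v`, and every element of `Zb v` is a branch of the cascade edge
        have key : ∀ y : 𝒢.graph.Star v, y ∈ Zb v →
            𝒢.graph.edgeOf y.1 = 𝒢.graph.edgeOf x.1 := by
          intro y hy
          have hy0 : 𝒢.graph.edgeOf y.1 ≠ 𝒢.graph.edgeOf b₂ := fun h =>
            hvv' (Option.some_injective _ ((y.2).symm.trans (hbad_both v' hv' y.1 h)))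
          rcases hy with h | ⟨v'', hv'', b_y, hby, hbyv''⟩
          · exact absurd h hy0
          · have hv''v' : v'' = v' := hbad_unique v'' v' hv'' hv'
            subst hv''v'
            -- `bx` and `b_y` are branches at the obstructed vertex outside `Zb0`: equal
            have hx0' : 𝒢.graph.edgeOf x.1 ≠ 𝒢.graph.edgeOf b₂ := hx0
            have := hbad_one v'' hv'' ⟨bx, hbxv'⟩ ⟨b_y, hbyv''⟩
              (by simp only [Zb0, Set.mem_setOf_eq, hbx]; exact hx0')
              (by simp only [Zb0, Set.mem_setOf_eq, hby]; exact hy0)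
            have hbb : bx = b_y := congrArg Subtype.val this
            rw [← hby, ← hbb, hbx]
        intro y hy z hz
        have hy' := key y hy
        have hz' := key z hz
        -- `y`, `z` (at `v`) and `bx` (at `v' ≠ v`) are branches of one edge
        rcases branch_eq_or_eq_or_eq hy' hz' hbx with h | h | h
        · exact Subtype.ext h
        · exact absurd ((y.2).symm.trans (h ▸ hbxv')) (fun h' => hvv' (Option.some_injective _ h'))
        · exact absurd ((z.2).symm.trans (h ▸ hbxv')) (fun h' => hvv' (Option.some_injective _ h'))
    · -- obstructed vertex: every edge at `v` is in `E₁`; kill everything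
      refine ⟨⊤, isOpen_univ, inferInstance, by simp, fun b Fe _ => ?_⟩
      haveI : FiberFunctor ((𝒢.pull b.1 v b.2).pullback ⋙ Fe) := fiberFunctor_comp_of_exact _ Fe
      obtain ⟨α⟩ := nonempty_iso_of_fiberFunctor ((𝒢.pull b.1 v b.2).pullback ⋙ Fe) (Fv v)
      refine ⟨α, fun _ => le_top, fun hb => absurd ?_ hb⟩
      exact Or.inr ⟨v, hv, b.1, rfl, b.2⟩
  -- glue
  obtain ⟨A, htriv, hnontriv⟩ := hS.exists_bObj_trivial_iff_mem E₁ hn1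
    (fun e => GaloisCategory.getFiberFunctor (𝒢.E e)) hgood
  have he₂ : 𝒢.graph.edgeOf b₂ ∈ E₁ := Or.inl rfl
  have he₁ : 𝒢.graph.edgeOf b₁ ∉ E₁ := by
    rintro (h | ⟨v, hv, b, hb, hbv⟩)
    · exact hne h
    · exact hbad_e₁ v hv b hb hbv
  obtain ⟨e1⟩ := nonempty_iso_of_fiberFunctor (GaloisCategory.getFiberFunctor (𝒢.E (𝒢.graph.edgeOf b₁))) F₁
  obtain ⟨e2⟩ := nonempty_iso_of_fiberFunctor (GaloisCategory.getFiberFunctor (𝒢.E (𝒢.graph.edgeOf b₂))) F₂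
  exact ⟨A, smul_eq_self_of_iso e2 _ (htriv b₂ v₂ h₂ he₂),
    exists_smul_ne_of_iso e1 _ (hnontriv b₁ v₁ h₁ he₁)⟩

/-- **Kernel form at the basepoint through the vertex of `e₁`.**  Under the hypotheses of
`exists_bObj_trivial_nontrivial`, for the basepoint of `B(𝒢)` through `v₁` induced from a basepoint
`F₁` of `𝒢_{e₁}` along `b₁`, there is an object `A ∈ B(𝒢)`, trivial over `e₂`, such that the image of
`Π_{b₁} → Π_𝒢` is NOT contained in the kernel `U ⊴ Π_𝒢` of the action of `Π_𝒢` on the fibre of `A`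
— while the branch groups of `e₂` act trivially on the fibres of `A` (`exists_bObj_trivial_nontrivial`
with `BranchActionOnFibre`). [cite: MochizukiSemiAnbd2006, Rem. 2.10.1 p.32] -/
theorem IsOfSurfaceType.exists_bObj_not_le_ker (hS : 𝒢.IsOfSurfaceType Sigma)
    (b₁ : 𝒢.graph.Branch) (v₁ : 𝒢.graph.Vertex) (h₁ : 𝒢.graph.abuts b₁ = some v₁)
    (b₂ : 𝒢.graph.Branch) (v₂ : 𝒢.graph.Vertex) (h₂ : 𝒢.graph.abuts b₂ = some v₂)
    (hne : 𝒢.graph.edgeOf b₁ ≠ 𝒢.graph.edgeOf b₂)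
    (hloop : ∀ v : 𝒢.graph.Vertex,
      (∀ b, 𝒢.graph.edgeOf b = 𝒢.graph.edgeOf b₂ → 𝒢.graph.abuts b = some v) →
      (∃ b, 𝒢.graph.edgeOf b = 𝒢.graph.edgeOf b₁ ∧ 𝒢.graph.abuts b = some v) →
      ∀ b, 𝒢.graph.edgeOf b = 𝒢.graph.edgeOf b₁ → 𝒢.graph.abuts b = some v)
    (F₁ : 𝒢.E (𝒢.graph.edgeOf b₁) ⥤ FintypeCat.{v₁}) [FiberFunctor F₁]
    (F₂ : 𝒢.E (𝒢.graph.edgeOf b₂) ⥤ FintypeCat.{v₁}) [FiberFunctor F₂]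
    (F : 𝒢.V v₁ ⥤ FintypeCat.{v₁}) (α : (𝒢.pull b₁ v₁ h₁).pullback ⋙ F₁ ≅ F) :
    ∃ A : 𝒢.BObj,
      (∀ (σ : Aut F₂) (y : F₂.obj (A.T (𝒢.graph.edgeOf b₂))), σ • y = y) ∧
      ¬ (𝒢.branchSubgroup F b₁ h₁ F₁ α).map (𝒢.piVToPi v₁ F) ≤
          (MulAction.toPermHom (𝒢.Pi v₁ F) ((𝒢.ρ v₁ ⋙ F).obj A)).ker := by
  obtain ⟨A, htriv, hnt⟩ :=
    hS.exists_bObj_trivial_nontrivial b₁ v₁ h₁ b₂ v₂ h₂ hne hloop F₁ F₂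
  exact ⟨A, htriv, not_map_piVToPi_branchSubgroup_le_ker_of_edge_nontrivial A F b₁ h₁ F₁ α hnt⟩

end SemiGraphOfAnabelioids

end Literature.AnabelianGeometry.SemiGraphs
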